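import Mathlib

/-!
# STUB-IDEAS k2 g18 — `stub_heegnerIndexLowerAtTwo` (crux 27851 `PrintCf2.SplitBadTwoLowerHalfOfFacts`)

Technique: literature transfer (recent-theorem harvest; typed dictionary).
Executes the critic's sidea assignments STUB-PLAN v3.9 §6 (β) **P-R133 = B22♯** and **R136**:

* §A `SameTensor` — the SAME-PURE-TENSOR QUOTIENT of Liu–Zhang–Zhang, *p-adic Waldspurger* (arXiv:1511.08172)
  Thm 3.10 by Yuan–Zhang–Zhang, *Gross–Zagier on Shimura curves* (AMS Studies 184) Thm 1.2: both are
  identities between two vectors of the ≤ 1-dimensional space `Hom_{𝔸_E^×}(Π⁺⊗χ, ·) ⊗ Hom(Π⁻⊗χ⁻¹, ·)`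
  with the SAME generator `α♮ = ⊗_{v<∞} α♮_v` (LZZ Def 4.4 = YZZ (1.3.2)); on any pure tensor with
  `α♮(f₊,f₋) ≠ 0` the local functional cancels at EVERY finite place INCLUDING `𝔭 | 2`
  (`quotient_testVectorFree`, `alpha_ne_zero_iff`): `𝓛(A)(χ)·(L²/ε)_𝔭(χ)·⟨y,y^∨⟩ = c_GZ·L′(½,π_A,χ)·log y·log y^∨`.
* §B `Kraus` — the TWIST-PERIOD / DIFFERENTIAL digit of R136, pinned by Kraus' integrality conditions at 2
  (Kraus 1989 Prop. 2 = Cremona–Fisher–Stoll MRL 14 (2007) Thm 2.8): the naive twist invariants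
  `(105 d², 1323 d³)` of `cm7^{(d)}`, `d ≡ 2, 3 (4)`, admit NO integral model, the `2`-scaled ones do;
  hence the minimalising `u` has `u⁴ = 16`, `ω_W = ± ω_{cm7}/(2√d)`, `Ω_W·√|d| = Ω^{sgn d}(cm7)/2` on all six keys.
* §C `Ledger` — R136's explicit-digit table in `e`-units (`e = 2·v₂`) as an affine function of the
  2-depth `n_v = 2 + [2 ∣ d]`; the two-anchor gap formula and the key-free criterion (`γ₁ = 1`, R130).
* §D `(γ)` hygiene — valuation transport to the weight-0 limit point needs only continuity + eventual
  constancy (`norm_lim_of_eventually_const`), no `Λ^{ur}`-structure of `u(d)`.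

Nothing here closes the stub; BSD is NOT proved by any of this. Mathlib-only, 0 sorry.
-/

set_option linter.dupNamespace false
set_option autoImplicit false

namespace Summit.BirchSwinnertonDyer.BirchSwinnertonDyer.Cruxes.SplitBadTwoLowerHalfOfFacts.StubIdeasK2G18

/-! ## §A  Same-pure-tensor quotient (P-R133 / B22♯) -/
section SameTensor

variable {K : Type*} [Field K]

/-- **B22♯ quotient, test-vector free.** `l` = `log_{ω₊}P⁺_χ(f₊)·log_{ω₋}P⁻_χ(f₋)`, `h` = `⟨P_χ(f₊),P_{χ⁻¹}(f₋)⟩`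
on ONE pure tensor; `s` = the product of the two scalars by which `P^±(f_±)` sit on the canonical lines
(`P⁺(f₊) = s₊·y`, `P⁻(f₋) = s₋·y^∨`, `s = s₊ s₋`), so `l = s·(log y · log y^∨)` and `h = s·⟨y,y^∨⟩`.
LZZ Thm 3.10: `l = Lθ·c·α` (`Lθ = 𝓛(A)(χ)`, `c = (L²/ε)_𝔭(χ)`); YZZ Thm 1.2: `h = Λ·α`
(`Λ = ζ_F(2)L′(½,π_A,χ)/(4L(1,η)²L(1,π_A,ad))`). If `α = α♮(f₊,f₋) ≠ 0` and `Λ ≠ 0` (rank one) then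
`Lθ·c·⟨y,y^∨⟩ = Λ·(log y·log y^∨)` — no test vector, CM point, or local functional survives. -/
theorem quotient_testVectorFree {Lθ c Λ α s logProd ht : K}
    (hα : α ≠ 0) (hΛ : Λ ≠ 0)
    (hLZZ : s * logProd = Lθ * c * α) (hYZZ : s * ht = Λ * α) :
    Lθ * c * ht = Λ * logProd := by
  have hs : s ≠ 0 := by
    rintro rfl
    exact (mul_ne_zero hΛ hα) (by simpa using hYZZ.symm)
  have key : s * α * (Lθ * c * ht) = s * α * (Λ * logProd) := by
    linear_combination (Lθ * c * α) * hYZZ - (Λ * α) * hLZZ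
  exact mul_left_cancel₀ (mul_ne_zero hs hα) key

/-- The scalar `s` is forced nonzero by the height side alone (`Λα ≠ 0`): the pure tensor need not be a
Gross–Prasad test vector, only `α♮(f₊,f₋) ≠ 0` (YZZ p. 100: "(1) holds for all `(f₁,f₂)` iff for some with
`α(f₁,f₂) ≠ 0`"). -/
theorem scalar_ne_zero_of_height_side {Λ α s ht : K} (hα : α ≠ 0) (hΛ : Λ ≠ 0)
    (hYZZ : s * ht = Λ * α) : s ≠ 0 ∧ ht ≠ 0 := by
  have h : s * ht ≠ 0 := by rw [hYZZ]; exact mul_ne_zero hΛ hα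
  exact ⟨left_ne_zero_of_mul h, right_ne_zero_of_mul h⟩

/-- `α♮ = ∏_{v ∈ S} α♮_v` (finitely many non-trivial places): nonvanishing is place-by-place, so the
legitimacy question AT `v = 2` is exactly `α♮_𝔭(f₊𝔭, f₋𝔭; χ_𝔭) ≠ 0` and nothing else. -/
theorem alpha_ne_zero_iff {ι : Type*} (S : Finset ι) (αv : ι → K) :
    (∏ v ∈ S, αv v) ≠ 0 ↔ ∀ v ∈ S, αv v ≠ 0 :=
  Finset.prod_ne_zero_iff

/-- LZZ Lemma 4.7 shape at `𝔭 | 2`: for `n`-admissible stable vectors and `χ_𝔭` of depth `n`,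
`(L²/ε)_𝔭·α♮_𝔭(f₊,f₋;χ) = κ · (∫ f₊)(∫ Π⁻(J) f₋)` with `κ ≠ 0` `χ`-free; it is nonzero as soon as the
two `χ`-FREE integrals are. -/
theorem stableLocalConstant_ne_zero {κ Ip Im : K} (hκ : κ ≠ 0) (hp : Ip ≠ 0) (hm : Im ≠ 0) :
    κ * (Ip * Im) ≠ 0 :=
  mul_ne_zero hκ (mul_ne_zero hp hm)

end SameTensor

/-! ## §B  Kraus' conditions at 2 and the twist-period digit of `cm7^{(d)}` (R136) -/
section Kraus

/-- Kraus' condition at `2` for integer invariants `(c₄, c₆)` (Kraus 1989 Prop. 2; Cremona–Fisher–Stoll 2007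
Thm 2.8 (ii)): `c₆ ≡ −1 (mod 4)`, or `2⁴ ∣ c₄` and `c₆ ≡ 0, 8 (mod 32)`. -/
def KrausAt2 (c₄ c₆ : ℤ) : Prop :=
  c₆ % 4 = 3 ∨ ((16 : ℤ) ∣ c₄ ∧ (c₆ % 32 = 0 ∨ c₆ % 32 = 8))

/-- `cm7 = [1,−1,0,−2,−1]` has `(c₄, c₆) = (105, 1323)`; the tree's `cm7.quadraticTwist d` has
`(c₄, c₆) = (105 d², 1323 d³)` (direct computation from `⟨0, −3d/4, 0, −2d², −d³⟩`). -/
theorem cm7_c4_c6 : (1 : ℤ) ^ 2 * 0 + (105 : ℤ) ^ 3 - 1323 ^ 2 = 1728 * (-343) := by norm_num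

/-- **The naive twist invariants admit no integral model for `d ≡ 2, 3 (mod 4)`.** -/
theorem kraus2_fails_naiveTwist (d : ℤ) (hd : d % 4 = 2 ∨ d % 4 = 3) :
    ¬ KrausAt2 (105 * d ^ 2) (1323 * d ^ 3) := by
  rintro (h6 | ⟨h16, -⟩)
  · -- `1323 d³ ≡ 3 d³ ≢ −1 (mod 4)` unless `d ≡ 1 (mod 4)`
    rcases hd with hd | hd
    · have hm : Int.ModEq 4 d 2 := by unfold Int.ModEq; omega
      have := (hm.pow 3).mul_left 1323
      unfold Int.ModEq at this
      generalize d ^ 3 = z at this h6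
      omega
    · have hm : Int.ModEq 4 d 3 := by unfold Int.ModEq; omega
      have := (hm.pow 3).mul_left 1323
      unfold Int.ModEq at this
      generalize d ^ 3 = z at this h6
      omega
  · -- `2⁴ ∣ 105 d²` forces `4 ∣ d`
    have hcop : IsCoprime (16 : ℤ) 105 := by
      rw [Int.isCoprime_iff_gcd_eq_one]; decide
    have h' : (16 : ℤ) ∣ d ^ 2 := hcop.dvd_of_dvd_mul_left (by simpa [mul_comm] using h16)
    have h4 : (4 : ℤ) ∣ d := by
      have : (4 : ℤ) ^ 2 ∣ d ^ 2 := by simpa using h'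
      exact (Int.pow_dvd_pow_iff two_ne_zero).mp this
    omega

/-- **The `2`-scaled invariants `(2⁴·105d², 2⁶·1323d³)` satisfy Kraus' condition at 2** (for every `d`). -/
theorem kraus2_holds_scaledTwist (d : ℤ) :
    KrausAt2 (2 ^ 4 * (105 * d ^ 2)) (2 ^ 6 * (1323 * d ^ 3)) := by
  refine Or.inr ⟨dvd_mul_right _ _, Or.inl ?_⟩
  have : (2 : ℤ) ^ 6 * (1323 * d ^ 3) = 32 * (2 * (1323 * d ^ 3)) := by ring
  rw [this, Int.mul_emod_right]

/-- Kraus' condition at `3` (`ord₃ c₆ ≠ 2`) is automatic: `27 ∣ 1323 d³` and `27 ∣ 2⁶·1323 d³`. -/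
theorem kraus3_ok (d : ℤ) : (27 : ℤ) ∣ 1323 * d ^ 3 ∧ (27 : ℤ) ∣ 2 ^ 6 * (1323 * d ^ 3) :=
  ⟨Dvd.dvd.mul_right (by norm_num) _, Dvd.dvd.mul_left (Dvd.dvd.mul_right (by norm_num) _) _⟩

/-- Hence the change of variables `C` with `C • W = cm7.quadraticTwist d` (`W` globally minimal,
`c₄(C • W) = u⁻⁴ c₄(W)`) has `u⁴ = 2⁴`, i.e. `|u| = 2`: by `realPeriodRat_smul`,
`Ω(cm7^{(d)}_{naive}) = 2·Ω(W)` and `ω_W = ± ω_{cm7}/(2√d)` — the twist-period digit `t_Ω = −1`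
and the differential digit `v₂((log_{ω_{cm7}}/log_{ω_W})²) = v₂(4d) = n_v` on ALL SIX keys. -/
theorem abs_u_eq_two {u : ℚ} (h : u ^ 4 = 16) : |u| = 2 := by
  have hfac : (u ^ 2 - 4) * (u ^ 2 + 4) = 0 := by nlinarith [h]
  rcases mul_eq_zero.mp hfac with h1 | h1
  · have hu2 : |u| ^ 2 = 4 := by rw [sq_abs]; linarith
    nlinarith [abs_nonneg u, hu2, sq_nonneg (|u| - 2), sq_nonneg (|u| + 2)]
  · nlinarith [sq_nonneg u]

/-- The rational skeleton of YZZ's constant for `E = K₀ = ℚ(√−7)` (`h = 1`, `w = 2`):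
finite reading `ζ(2)/(4 L(1,η)²) = (π²/6)/(4π²/7) = 7/24 = 2⁻³·(7/3)`; YZZ's complete reading (all
`L`-functions include archimedean factors, YZZ §1.6.5) `(π/6)/(4/7) = 7π/24`, and with
`L_∞′(½,π,χ)/L_∞(1,π,ad) = π⁻²·2π³` the skeleton is `7/12 = 2⁻²·(7/3)` times `π²`. KEY-FREE either way. -/
theorem cGZ_skeleton :
    ((1 : ℚ) / 6) / (4 * (1 / 7)) = 7 / 24 ∧ (7 : ℚ) / 24 = 2 ^ (-3 : ℤ) * (7 / 3) ∧
      (7 : ℚ) / 24 * 2 = 7 / 12 ∧ (7 : ℚ) / 12 = 2 ^ (-2 : ℤ) * (7 / 3) := by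
  norm_num

end Kraus

/-! ## §C  R136 explicit-digit ledger in `e`-units (`e = 2·v₂`), as a function of the 2-depth `n_v` -/
section Ledger

/-- One column per conversion factor between `𝓛(A_{f₀})(χ′_d)` and S2′'s exponent `m`
(`Q(W) := val·Ω_W·ĥ(P)/(L′(W,1)·log_{ω_W}(P)²)`, `e_A = 2 v₂ Q`), each in `e`-units:
* `kappa`  — KEY-FREE lump: `c_GZ` skeleton (`−3`/`−2`) ⊕ Petersson/`L(1,π_{f₀},ad)` ⊕ measures ⊕ the
  `ξ`-realisation `r_ξ/h_ξ` (fixed good pair, conductor prime to 2) ⊕ `a₀` (`u(d) = 2^{a₀}·unit`, R121″/R133 (i))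
  ⊕ `|Ω⁻/Ω⁺|(cm7) = √7` (unit) ⊕ `Ω_p` (unit);
* `(L²/ε)_𝔭(χ′_d)`: `L(½, π_𝔭⊗χ′) = 1` (ramified twist of unramified `π_𝔭`) and `ε = ω_π(2)^{n_v}·χ′(−1)`-type
  root of unity ⟹ `0`;
* differential `(log_{ω_{cm7}}/log_{ω_W})² = 4d` ⟹ `+2 n_v` (`v₂(4d) = 2 + [2∣d] = n_v`);
* twist period `Ω_W = Ω^{sgn}(cm7)/(2√|d|)` ⟹ `−2 − (n_v − 2) = −n_v`;
* Néron–Tate height under the twist isomorphism (absolute height) ⟹ `0`;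
* the twin's algebraic `L`-value `L(μ̃_d,1)` CANCELS between `L′(½,π_{f₀}×χ′_d) = L′(W,1)·L(μ̃_d,1)` and `Kb`;
* `Kb`'s residue `g37` (Katz (5.3.0)/de Shalit II.4.14 (37) constants of the in-range twin: Gauss sum /
  root number and conductor of `μ̃_{d,2}`, Euler-type factors `= 1`): `−(γ₀ + γ₁·n_v)`;
* Manin constant, `deg φ`, `u_K`, `|D_K|^{1/2}`, `[K:ℚ]`: ABSENT in the `(π)`/LZZ currency (GZ86-currency artefacts). -/
def eA (kappa γ₀ γ₁ n : ℤ) : ℤ :=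
  2 * kappa + 0 + 2 * n + (-n) + 0 + 0 - (γ₀ + γ₁ * n)

/-- **Depth-affine law.** `e_A = (2κ − γ₀) + (1 − γ₁)·n_v`. -/
theorem eA_affine (kappa γ₀ γ₁ n : ℤ) :
    eA kappa γ₀ γ₁ n = (2 * kappa - γ₀) + (1 - γ₁) * n := by
  unfold eA; ring

/-- **Two-anchor gap** (the R112 test in numbers): an even-key anchor (`n_v = 3`) minus an odd-key anchor
(`n_v = 2`) reads `1 − γ₁`, whatever the key-free lump. -/
theorem eA_gap (kappa γ₀ γ₁ : ℤ) : eA kappa γ₀ γ₁ 3 - eA kappa γ₀ γ₁ 2 = 1 - γ₁ := by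
  unfold eA; ring

/-- **Key-free criterion.** `e_A` is one constant on all six keys iff the twin's Gauss column has slope
`γ₁ = 1` in `e`-units — which is R130's booked single in-range value `+n_v`. -/
theorem eA_keyFree_iff (kappa γ₀ γ₁ : ℤ) :
    (∀ n n' : ℤ, eA kappa γ₀ γ₁ n = eA kappa γ₀ γ₁ n') ↔ γ₁ = 1 := by
  constructor
  · intro h
    have := h 3 2
    rw [eA_affine, eA_affine] at this
    linarith
  · rintro rfl n n'
    simp [eA_affine]

/-- With R130's booking `γ₁ = 1`: ONE BSD₂-exact anchor of any key fixes `e_A` on all six keys. -/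
theorem eA_const_of_R130 (kappa γ₀ : ℤ) (n : ℤ) : eA kappa γ₀ 1 n = 2 * kappa - γ₀ := by
  rw [eA_affine]; ring

/-- The six dyadic keys `(d mod 2, d′ mod 8)` and their depth `n_v = 2 + [2 ∣ d]`; the ledger factors
through `depth` (k3-g17's `DepthOnly`, here with the columns filled in). -/
def depth (k : ℤ × ℤ) : ℤ := if k.1 = 1 then 2 else 3

theorem eA_through_depth (kappa γ₀ γ₁ : ℤ) (k k' : ℤ × ℤ) (h : depth k = depth k') :
    eA kappa γ₀ γ₁ (depth k) = eA kappa γ₀ γ₁ (depth k') := by rw [h]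

end Ledger

/-! ## §D  (γ) hygiene: valuation transport to the weight-0 point needs no `Λ^{ur}` structure -/
section Transport

open Filter Topology

/-- If `c_m → c_∞` and `‖c_m‖ = r` for all large `m`, then `‖c_∞‖ = r`. Applied to
`c_m := 𝓛(x_m)/(Ka(x_m)·Kb(x_m))` along the in-range points `x_m → x_∞` (weight `2^m → 0` 2-adically,
`tendsto_pow_two_pow_sub_one`), with `Ka(x_∞)·Kb(x_∞) ≠ 0` (Bertrand at 2 / `L(μ̃,1) ≠ 0`): the column-wise
cancellation `v₂ c_m = a₀` (rows 49/51) passes to the limit — no boundedness or unit structure of `u(d)` used. -/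
theorem norm_lim_of_eventually_const {E : Type*} [SeminormedAddCommGroup E]
    {c : ℕ → E} {x : E} {r : ℝ} (hlim : Tendsto c atTop (𝓝 x))
    (hr : ∀ᶠ m in atTop, ‖c m‖ = r) : ‖x‖ = r :=
  tendsto_nhds_unique hlim.norm (tendsto_const_nhds.congr' (hr.mono fun _ hm => hm.symm))

/-- The quotient form used above: if `N_m → N`, `D_m → D ≠ 0` then `N_m/D_m → N/D`. -/
theorem tendsto_div_of_ne_zero {K : Type*} [NormedField K] {N D : ℕ → K} {n d : K}
    (hN : Tendsto N atTop (𝓝 n)) (hD : Tendsto D atTop (𝓝 d)) (hd : d ≠ 0) :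
    Tendsto (fun m => N m / D m) atTop (𝓝 (n / d)) :=
  hN.div hD hd

end Transport

end Summit.BirchSwinnertonDyer.BirchSwinnertonDyer.Cruxes.SplitBadTwoLowerHalfOfFacts.StubIdeasK2G18
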